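import Mathlib
import Summits.Ventures.PercRepro2.OneEdge
import Summits.Ventures.PercRepro2.KPrimeReduction
import Summits.Ventures.PercRepro2.KPrimeSure
import Summits.Ventures.PercRepro2.KPrimeEdgeSteps
import Summits.Ventures.PercRepro2.KPrimePendantLemmas
import Summits.Ventures.PercRepro2.KPrimePendantB

/-!
# A vertex with exactly two edges (a pendant with a LEAK): the pinned-world dictionary
(blind cell PercRepro2, mine-c g37; `conjectures/MINE-C.md` §46.3)

Let the vertex `b` have exactly two edges, `f = {b, x₁}` and `g = {b, x₂}`.  With `g` pinned
CLOSED, `b` is a leaf at `x₁`: the events among the other vertices do not depend on the state of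
`f` (`PendInv`, the two-edge form of g33's flip invariance), their masses are the same with `f`
pinned open or closed (`prob_update_one_eq_update_zero_of_pendInv`), and `{x₁ ↔ b}` carries the
factor `p f` (`prob_inter_connEvent_b_of_closed`).  With `g` pinned OPEN and `f` pinned closed,
`b` is a leaf at `x₂` by a sure edge and `{s ↔ b}` is `{s ↔ x₂}` (`prob_inter_connEvent_b_of_open`).
These are the four pinned worlds of the leak expansion of `MINE-C.md` §46.3 (the fourth, both
edges open, is the glued instance and needs no dictionary: its masses are taken as they are).
-/

namespace Summit.Ventures.PercRepro2

namespace KPrime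

variable {V : Type*} {E : Type*} [Fintype E] [DecidableEq E] [Fintype V] [DecidableEq V]
  {R : Type*} [Field R] [LinearOrder R] [IsStrictOrderedRing R]

section TwoEdges

variable {ends : E → Sym2 V} {b x₁ x₂ : V} {f g : E} {p : E → R}

omit [Fintype E] [DecidableEq E] [Fintype V] [DecidableEq V] [Field R] [LinearOrder R]
  [IsStrictOrderedRing R] in
/-- With both of its edges closed, `b` is isolated. -/
lemma conn_eq_of_isolated₂ (hb : ∀ f', b ∈ ends f' → f' = f ∨ f' = g) {ω : Config E}
    (hf : ω f = false) (hg : ω g = false) {x : V} (h : Conn ends ω b x) : x = b := by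
  have hS : ∀ y ∈ ({b} : Set V), ∀ z, (openGraph ends ω).Adj y z → z ∈ ({b} : Set V) := by
    intro y hy z hyz
    have hy' : y = b := Set.mem_singleton_iff.1 hy
    rw [hy', openGraph_adj] at hyz
    obtain ⟨_, f', hf', hends'⟩ := hyz
    have hmem : b ∈ ends f' := by rw [hends']; exact Sym2.mem_mk_left _ _
    rcases hb f' hmem with hf'' | hg''
    · rw [hf'', hf] at hf'; exact absurd hf' Bool.false_ne_true
    · rw [hg'', hg] at hf'; exact absurd hf' Bool.false_ne_true
  exact mem_of_conn_of_closed hS (Set.mem_singleton b) h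

omit [Fintype E] [Fintype V] [DecidableEq V] [Field R] [LinearOrder R] [IsStrictOrderedRing R] in
/-- With `g` closed, opening or closing `f` does not change the connections among the vertices
other than `b`. -/
lemma conn_update_f_iff_of_closed_g (hb : ∀ f', b ∈ ends f' → f' = f ∨ f' = g)
    (hfx : ends f = s(b, x₁)) (hfg : f ≠ g) {ω : Config E} (hg : ω g = false) {s x : V}
    (hs : s ≠ b) (hx : x ≠ b) :
    Conn ends (Function.update ω f true) s x ↔ Conn ends (Function.update ω f false) s x := by
  set ω' := Function.update ω f false with hω'
  have hf' : ω' f = false := by simp [hω']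
  have hg' : ω' g = false := by simp [hω', Function.update_of_ne hfg.symm, hg]
  have hup : Function.update ω f true = Function.update ω' f true := by
    simp [hω', Function.update_idem]
  rw [hup, OneEdge.conn_update_true_iff hfx]
  constructor
  · rintro (h | ⟨h1, _⟩ | ⟨_, h2⟩)
    · exact h
    · exact absurd (conn_eq_of_isolated₂ hb hf' hg' (conn_symm h1)) hs
    · exact absurd (conn_eq_of_isolated₂ hb hf' hg' h2) hx
  · exact fun h => Or.inl h

omit [Fintype E] [Fintype V] [DecidableEq V] [Field R] [LinearOrder R] [IsStrictOrderedRing R] in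
/-- With `g` closed and `f` open, `b` is connected exactly to what `x₁` is connected to. -/
lemma conn_b_iff_conn_x₁ (hb : ∀ f', b ∈ ends f' → f' = f ∨ f' = g)
    (hfx : ends f = s(b, x₁)) (hfg : f ≠ g) {ω : Config E} (hg : ω g = false) (hf : ω f = true)
    {s : V} (hs : s ≠ b) : Conn ends ω s b ↔ Conn ends ω s x₁ := by
  have hbx : Conn ends ω b x₁ := conn_of_openAdj ⟨f, hf, hfx⟩
  constructor
  · intro h
    set ω' := Function.update ω f false with hω'
    have hf' : ω' f = false := by simp [hω']
    have hg' : ω' g = false := by simp [hω', Function.update_of_ne hfg.symm, hg]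
    have hωeq : ω = Function.update ω' f true := by
      rw [hω', Function.update_idem, ← hf, Function.update_eq_self]
    have h' := h
    rw [hωeq, OneEdge.conn_update_true_iff hfx] at h'
    rcases h' with h' | ⟨h1, _⟩ | ⟨h1, _⟩
    · exact absurd (conn_eq_of_isolated₂ hb hf' hg' (conn_symm h')) hs
    · exact absurd (conn_eq_of_isolated₂ hb hf' hg' (conn_symm h1)) hs
    · have hsx : Conn ends ω' s x₁ := h1
      have hle : ω' ≤ ω := by
        intro e'
        by_cases he' : e' = f
        · subst he'; simp [hω']
        · simp [hω', Function.update_of_ne he']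
      exact (conn_mono hle hsx)
  · intro h
    exact conn_trans h (conn_symm hbx)

/-- `A` does not depend on the state of `f` on the configurations with `g` closed. -/
def PendInv (f g : E) (A : Set (Config E)) : Prop :=
  ∀ ω : Config E, ω g = false →
    (Function.update ω f true ∈ A ↔ Function.update ω f false ∈ A)

omit [Fintype E] [Fintype V] [DecidableEq V] [Field R] [LinearOrder R]
  [IsStrictOrderedRing R] in
/-- `PendInv` is closed under intersection. -/
lemma PendInv.inter {A B : Set (Config E)} (hA : PendInv f g A) (hB : PendInv f g B) :
    PendInv f g (A ∩ B) := fun ω hω => by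
  simp only [Set.mem_inter_iff, hA ω hω, hB ω hω]

omit [Fintype E] [Fintype V] [DecidableEq V] [Field R] [LinearOrder R]
  [IsStrictOrderedRing R] in
/-- `PendInv` is closed under union. -/
lemma PendInv.union {A B : Set (Config E)} (hA : PendInv f g A) (hB : PendInv f g B) :
    PendInv f g (A ∪ B) := fun ω hω => by
  simp only [Set.mem_union, hA ω hω, hB ω hω]

omit [Fintype E] [Fintype V] [DecidableEq V] [Field R] [LinearOrder R]
  [IsStrictOrderedRing R] in
/-- `PendInv` is closed under complement. -/
lemma PendInv.compl {A : Set (Config E)} (hA : PendInv f g A) : PendInv f g Aᶜ :=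
  fun ω hω => by simp only [Set.mem_compl_iff, hA ω hω]

omit [Fintype E] [Fintype V] [DecidableEq V] [Field R] [LinearOrder R] [IsStrictOrderedRing R] in
/-- A connection event between vertices other than `b`. -/
lemma pendInv_connEvent (hb : ∀ f', b ∈ ends f' → f' = f ∨ f' = g) (hfx : ends f = s(b, x₁))
    (hfg : f ≠ g) {s x : V} (hs : s ≠ b) (hx : x ≠ b) : PendInv f g (connEvent ends s x) :=
  fun ω hω => by
    simp only [mem_connEvent]
    exact conn_update_f_iff_of_closed_g hb hfx hfg hω hs hx

omit [Fintype E] [Fintype V] [DecidableEq V] [Field R] [LinearOrder R] [IsStrictOrderedRing R] in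
/-- An avoidance event among vertices other than `b`. -/
lemma pendInv_avoidAll (hb : ∀ f', b ∈ ends f' → f' = f ∨ f' = g) (hfx : ends f = s(b, x₁))
    (hfg : f ≠ g) {s : V} (hs : s ≠ b) {X : Finset V} (hX : ∀ x ∈ X, x ≠ b) :
    PendInv f g (avoidAll ends s X) := fun ω hω => by
  simp only [avoidAll, Set.mem_setOf_eq]
  constructor
  · intro h x hxX hc
    exact h x hxX ((conn_update_f_iff_of_closed_g hb hfx hfg hω hs (hX x hxX)).2 hc)
  · intro h x hxX hc
    exact h x hxX ((conn_update_f_iff_of_closed_g hb hfx hfg hω hs (hX x hxX)).1 hc)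

omit [Fintype E] [Fintype V] [DecidableEq V] [IsStrictOrderedRing R] in
/-- A `PendInv` event, cut to `{g closed}`, is flip-invariant at `f` for every weight vector. -/
lemma flipInvAt_of_pendInv (hfg : f ≠ g) {A : Set (Config E)} (hA : PendInv f g A) :
    FlipInvAt p f (A ∩ closedEdge g) := by
  intro ω _
  by_cases hg : ω g = false
  · have h1 : Function.update ω f true ∈ closedEdge g := by
      simp [closedEdge, Function.update_of_ne hfg.symm, hg]
    have h0 : Function.update ω f false ∈ closedEdge g := by
      simp [closedEdge, Function.update_of_ne hfg.symm, hg]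
    simp only [Set.mem_inter_iff, h1, h0, and_true]
    exact hA ω hg
  · have hg' : ω g = true := by simpa using hg
    have h1 : Function.update ω f true ∉ closedEdge g := by
      simp [closedEdge, Function.update_of_ne hfg.symm, hg']
    have h0 : Function.update ω f false ∉ closedEdge g := by
      simp [closedEdge, Function.update_of_ne hfg.symm, hg']
    simp only [Set.mem_inter_iff, h1, h0, and_false]

omit [Fintype V] [DecidableEq V] [IsStrictOrderedRing R] in
/-- With `g` pinned closed, a `PendInv` event has the same mass with `f` pinned open or closed
(for EVERY weight of `f`, `1` included). -/
lemma prob_update_one_eq_update_zero_of_pendInv (hfg : f ≠ g) {A : Set (Config E)}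
    (hA : PendInv f g A) :
    prob (Function.update (Function.update p g 0) f 1) A =
      prob (Function.update (Function.update p g 0) f 0) A := by
  have he : Function.update (Function.update p g 0) f 0 f ≠ 1 := by simp
  have hflip := prob_update_one_eq_update_zero_of_flipInvAt
    (p := Function.update (Function.update p g 0) f 0) he
    (flipInvAt_of_pendInv (p := Function.update (Function.update p g 0) f 0) hfg hA)
  rw [Function.update_idem, Function.update_idem] at hflip
  have hc1 : Function.update (Function.update p g 0) f 1 =
      Function.update (Function.update p f 1) g 0 := Function.update_comm hfg.symm _ _ _
  have hc0 : Function.update (Function.update p g 0) f 0 =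
      Function.update (Function.update p f 0) g 0 := Function.update_comm hfg.symm _ _ _
  calc prob (Function.update (Function.update p g 0) f 1) A
      = prob (Function.update (Function.update p f 1) g 0) (A ∩ closedEdge g) := by
        rw [hc1, prob_update_zero_inter_closedEdge]
    _ = prob (Function.update (Function.update p g 0) f 1) (A ∩ closedEdge g) := by rw [hc1]
    _ = prob (Function.update (Function.update p g 0) f 0) (A ∩ closedEdge g) := hflip
    _ = prob (Function.update (Function.update p f 0) g 0) (A ∩ closedEdge g) := by rw [hc0]
    _ = prob (Function.update (Function.update p g 0) f 0) A := by
        rw [prob_update_zero_inter_closedEdge, hc0]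

omit [Fintype V] [DecidableEq V] [IsStrictOrderedRing R] in
/-- With `g` pinned closed, `{x₁ ↔ b} = {f open}` on the support: the mass of
`A ∩ {x₁ ↔ b}` is `p f` times the mass of `A` for every `PendInv` event `A`. -/
lemma prob_inter_connEvent_b_of_closed (hb : ∀ f', b ∈ ends f' → f' = f ∨ f' = g)
    (hfx : ends f = s(b, x₁)) (hfg : f ≠ g) (hbx : b ≠ x₁) {A : Set (Config E)}
    (hA : PendInv f g A) :
    prob (Function.update p g 0) (A ∩ connEvent ends x₁ b) =
      p f * prob (Function.update p g 0) A := by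
  set p' := Function.update p g 0 with hp'
  have hpf : p' f = p f := by simp [hp', Function.update_of_ne hfg]
  -- on `{g closed}`, `x₁ ↔ b` is `f` open
  have hset : A ∩ connEvent ends x₁ b ∩ closedEdge g = (A ∩ closedEdge g) ∩ openEdge f := by
    ext ω
    simp only [Set.mem_inter_iff, mem_connEvent, mem_closedEdge, mem_openEdge]
    constructor
    · rintro ⟨⟨hA', hc⟩, hg⟩
      refine ⟨⟨hA', hg⟩, ?_⟩
      by_contra hf
      have hf' : ω f = false := by simpa using hf
      exact hbx (conn_eq_of_isolated₂ hb hf' hg (conn_symm hc)).symm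
    · rintro ⟨⟨hA', hg⟩, hf⟩
      exact ⟨⟨hA', conn_symm (conn_of_openAdj ⟨f, hf, hfx⟩)⟩, hg⟩
  rw [← prob_update_zero_inter_closedEdge p (A ∩ connEvent ends x₁ b) g, ← hp', hset,
    prob_inter_openEdge_of_flipInvAt (flipInvAt_of_pendInv (p := p') hfg hA), hpf, hp',
    prob_update_zero_inter_closedEdge]

omit [Fintype V] [DecidableEq V] [LinearOrder R] [IsStrictOrderedRing R] in
/-- With `g` pinned OPEN and `f` pinned closed, `b` is a leaf at `x₂` by a sure edge: for a
vertex `s ≠ b`, the mass of `A ∩ {s ↔ b}` is the mass of `A ∩ {s ↔ x₂}`. -/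
lemma prob_inter_connEvent_b_of_open (hb : ∀ f', b ∈ ends f' → f' = f ∨ f' = g)
    (hgx : ends g = s(b, x₂)) (hfg : f ≠ g) {A : Set (Config E)} {s : V} (hs : s ≠ b) :
    prob (Function.update (Function.update p g 1) f 0) (A ∩ connEvent ends s b) =
      prob (Function.update (Function.update p g 1) f 0) (A ∩ connEvent ends s x₂) := by
  have hcomm : Function.update (Function.update p g 1) f 0 =
      Function.update (Function.update p f 0) g 1 := Function.update_comm hfg.symm _ _ _
  -- both sides live on `{f closed} ∩ {g open}`
  have hsupp : ∀ B : Set (Config E),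
      prob (Function.update (Function.update p g 1) f 0) B =
        prob (Function.update (Function.update p g 1) f 0) (B ∩ closedEdge f ∩ openEdge g) := by
    intro B
    rw [← prob_update_zero_inter_closedEdge (Function.update p g 1) B f]
    conv_lhs => rw [hcomm]
    rw [← prob_update_one_inter_openEdge (Function.update p f 0) (B ∩ closedEdge f) g, ← hcomm]
  have hset : A ∩ connEvent ends s b ∩ closedEdge f ∩ openEdge g =
      A ∩ connEvent ends s x₂ ∩ closedEdge f ∩ openEdge g := by
    ext ω
    simp only [Set.mem_inter_iff, mem_connEvent, mem_closedEdge, mem_openEdge]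
    constructor
    · rintro ⟨⟨⟨hA', hc⟩, hf⟩, hg⟩
      exact ⟨⟨⟨hA', (conn_b_iff_conn_x₁ (f := g) (g := f) (x₁ := x₂)
        (fun f' hf' => (hb f' hf').symm) hgx hfg.symm hf hg hs).1 hc⟩, hf⟩, hg⟩
    · rintro ⟨⟨⟨hA', hc⟩, hf⟩, hg⟩
      exact ⟨⟨⟨hA', (conn_b_iff_conn_x₁ (f := g) (g := f) (x₁ := x₂)
        (fun f' hf' => (hb f' hf').symm) hgx hfg.symm hf hg hs).2 hc⟩, hf⟩, hg⟩
  rw [hsupp (A ∩ connEvent ends s b), hset, ← hsupp]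

end TwoEdges

end KPrime

end Summit.Ventures.PercRepro2
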